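import Summits.Ventures.PercRepro.C025ProfilePLDPlaneLiftArith

/-!
# THE PLANE LIFT WITH THE PRESERVER 2·T₁₃ + 12·T₂₃ (β = 6): THE ARITHMETIC FOR RANK 10 (night-3 g35)

`proofs/NIGHT3-G35-BASEMAP.md` §2.  The joint LP (kit j331389, g34) puts the minimal `β` with `T₁₃ + β·T₂₃` a (PLD)-preserver at rank ≤ 10
at `5.600` (it is `2` at rank ≤ 6, `4` at rank 7, `4.045` at rank 8 and `4.747` at rank 9), so the rank-10 plane lift uses `q = 2·T₁₃ + 12·T₂₃`:
`2·(U_{3,m} − U_{3,m₀}) = k·q + k·(m + m₀ − 13)·T₂₃ + 2(c_m − c_{m₀})·δ₃₃` for `6 ≤ m₀ ≤ m`, `k = m − m₀` (the `T₂₃` coefficient is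
`k·(m + m₀ − 1) − 12k ≥ 0`: zero for `k = 0`, and `m + m₀ − 1 ≥ 12` once `k ≥ 1` and `m₀ ≥ 6` — the base 6 of the base map, g34 §3, is
exactly the base this identity needs).  g31's `sum_choose_min_three` and `two_mul_choose_two_sub` are reused, as in g32's `B5` module;
`lift_alg_b6`, `lift_instance_plane_b6`.  No `def`, no `instance`, no notation.  Axioms: standard.
-/

namespace PercRepro

open Finset

namespace PLDPlaneLiftB6

variable {ι : Type}

/-- The linear algebra of the plane lift, with the fourteen layer sums and the coefficients abstracted:
`2·C = 2·C₀ + k·(12 + u)` (= `two_mul_choose_two_sub` with `m = m₀ + k`, `k·(m + m₀ − 1) = k·(12 + u)`), with `q = 2·T₁₃ + 12·T₂₃`. -/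
theorem lift_alg_b6 (a03 a13 a23 a33 a32 a31 a30 b03 b13 b23 b33 b32 b31 b30 m₀ k k' u C C₀ c₀ : ℕ)
    (hC : 2 * C = 2 * C₀ + k * (12 + u))
    (h₀ : a03 + m₀ * a13 + C₀ * a23 + c₀ * a33 + C₀ * a32 + m₀ * a31 + a30 ≤
      b03 + m₀ * b13 + C₀ * b23 + c₀ * b33 + C₀ * b32 + m₀ * b31 + b30)
    (hq : 2 * a13 + 2 * a31 + 12 * a23 + 12 * a32 ≤ 2 * b13 + 2 * b31 + 12 * b23 + 12 * b32)
    (hT : a23 + a32 ≤ b23 + b32) (hS : a33 ≤ b33) :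
    a03 + (m₀ + k) * a13 + C * a23 + (c₀ + k') * a33 + C * a32 + (m₀ + k) * a31 + a30 ≤
      b03 + (m₀ + k) * b13 + C * b23 + (c₀ + k') * b33 + C * b32 + (m₀ + k) * b31 + b30 := by
  have e1 : 2 * C * a23 = (2 * C₀ + k * (12 + u)) * a23 := by rw [hC]
  have e2 : 2 * C * a32 = (2 * C₀ + k * (12 + u)) * a32 := by rw [hC]
  have e3 : 2 * C * b23 = (2 * C₀ + k * (12 + u)) * b23 := by rw [hC]
  have e4 : 2 * C * b32 = (2 * C₀ + k * (12 + u)) * b32 := by rw [hC]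
  have hqk := Nat.mul_le_mul_left k hq
  have hT2 := Nat.mul_le_mul_left (k * u) hT
  have hSk := Nat.mul_le_mul_left k' hS
  nlinarith [e1, e2, e3, e4, hqk, hT2, hSk, h₀]

/-- THE LIFT IN `m` FOR PLANES: for a family `(s, x, f)` with (PLD), `6 ≤ m₀ ≤ m`, an admissible `(lo, hi, δ, Θ)`, the
`q`-instance (`q = 2·T₁₃ + 12·T₂₃`) and the `U_{3,m₀}`-instance give the `U_{3,m}`-instance. -/
theorem lift_instance_plane_b6 (s : Finset ι) (x f : ι → ℕ)
    (hPLD : ∀ lo hi δ Θ : ℕ, Θ ≤ lo + hi + δ → (lo = 0 ∨ lo + hi + δ ≤ Θ) →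
      ∑ i ∈ s, (if lo ≤ x i ∧ x i ≤ hi ∧ Θ ≤ f i + x i then (f i).choose δ else 0) ≤
        ∑ i ∈ s, (if lo + δ ≤ f i ∧ f i ≤ hi + δ then (f i).choose δ else 0))
    (m₀ m : ℕ) (hm₀ : 6 ≤ m₀) (hm : m₀ ≤ m) (lo hi δ Θ : ℕ) (hΘ : Θ ≤ lo + hi + δ)
    (hlo : lo = 0 ∨ lo + hi + δ ≤ Θ)
    (hq : ∑ i ∈ s, (2 * (if lo ≤ x i + 1 ∧ x i + 1 ≤ hi ∧ Θ ≤ (f i + 3) + (x i + 1) then (f i + 3).choose δ else 0) +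
        2 * (if lo ≤ x i + 3 ∧ x i + 3 ≤ hi ∧ Θ ≤ (f i + 1) + (x i + 3) then (f i + 1).choose δ else 0) +
        12 * (if lo ≤ x i + 2 ∧ x i + 2 ≤ hi ∧ Θ ≤ (f i + 3) + (x i + 2) then (f i + 3).choose δ else 0) +
        12 * (if lo ≤ x i + 3 ∧ x i + 3 ≤ hi ∧ Θ ≤ (f i + 2) + (x i + 3) then (f i + 2).choose δ else 0)) ≤
      ∑ i ∈ s, (2 * (if lo + δ ≤ f i + 3 ∧ f i + 3 ≤ hi + δ then (f i + 3).choose δ else 0) +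
        2 * (if lo + δ ≤ f i + 1 ∧ f i + 1 ≤ hi + δ then (f i + 1).choose δ else 0) +
        12 * (if lo + δ ≤ f i + 3 ∧ f i + 3 ≤ hi + δ then (f i + 3).choose δ else 0) +
        12 * (if lo + δ ≤ f i + 2 ∧ f i + 2 ≤ hi + δ then (f i + 2).choose δ else 0)))
    (h₀ : ∑ i ∈ s, ∑ j ∈ range (m₀ + 1), Nat.choose m₀ j *
        (if lo ≤ x i + min j 3 ∧ x i + min j 3 ≤ hi ∧ Θ ≤ (f i + min (m₀ - j) 3) + (x i + min j 3) then
          (f i + min (m₀ - j) 3).choose δ else 0) ≤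
      ∑ i ∈ s, ∑ j ∈ range (m₀ + 1), Nat.choose m₀ j *
        (if lo + δ ≤ f i + min (m₀ - j) 3 ∧ f i + min (m₀ - j) 3 ≤ hi + δ then (f i + min (m₀ - j) 3).choose δ else 0)) :
    ∑ i ∈ s, ∑ j ∈ range (m + 1), Nat.choose m j *
        (if lo ≤ x i + min j 3 ∧ x i + min j 3 ≤ hi ∧ Θ ≤ (f i + min (m - j) 3) + (x i + min j 3) then
          (f i + min (m - j) 3).choose δ else 0) ≤
      ∑ i ∈ s, ∑ j ∈ range (m + 1), Nat.choose m j *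
        (if lo + δ ≤ f i + min (m - j) 3 ∧ f i + min (m - j) 3 ≤ hi + δ then (f i + min (m - j) 3).choose δ else 0) := by
  -- the preservers `T₂₃` and `δ₃₃` (the `(1,1)`-shift twice, then `coloop` / `shift11`)
  have h11 : ∀ lo hi δ Θ : ℕ, Θ ≤ lo + hi + δ → (lo = 0 ∨ lo + hi + δ ≤ Θ) →
      ∑ i ∈ s, (if lo ≤ x i + 1 ∧ x i + 1 ≤ hi ∧ Θ ≤ (f i + 1) + (x i + 1) then (f i + 1).choose δ else 0) ≤
        ∑ i ∈ s, (if lo + δ ≤ f i + 1 ∧ f i + 1 ≤ hi + δ then (f i + 1).choose δ else 0) :=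
    fun lo hi δ Θ h1 h2 => PLDClosure.shift11 s x f hPLD lo hi δ Θ h1 h2
  have h22 : ∀ lo hi δ Θ : ℕ, Θ ≤ lo + hi + δ → (lo = 0 ∨ lo + hi + δ ≤ Θ) →
      ∑ i ∈ s, (if lo ≤ x i + 2 ∧ x i + 2 ≤ hi ∧ Θ ≤ (f i + 2) + (x i + 2) then (f i + 2).choose δ else 0) ≤
        ∑ i ∈ s, (if lo + δ ≤ f i + 2 ∧ f i + 2 ≤ hi + δ then (f i + 2).choose δ else 0) :=
    fun lo hi δ Θ h1 h2 => PLDClosure.shift11 s (fun i => x i + 1) (fun i => f i + 1) h11 lo hi δ Θ h1 h2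
  have hT : ∑ i ∈ s, ((if lo ≤ x i + 2 ∧ x i + 2 ≤ hi ∧ Θ ≤ (f i + 3) + (x i + 2) then (f i + 3).choose δ else 0) +
        (if lo ≤ x i + 3 ∧ x i + 3 ≤ hi ∧ Θ ≤ (f i + 2) + (x i + 3) then (f i + 2).choose δ else 0)) ≤
      ∑ i ∈ s, ((if lo + δ ≤ f i + 3 ∧ f i + 3 ≤ hi + δ then (f i + 3).choose δ else 0) +
        (if lo + δ ≤ f i + 2 ∧ f i + 2 ≤ hi + δ then (f i + 2).choose δ else 0)) :=
    PLDClosure.coloop s (fun i => x i + 2) (fun i => f i + 2) h22 lo hi δ Θ hΘ hlo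
  have hS : ∑ i ∈ s, (if lo ≤ x i + 3 ∧ x i + 3 ≤ hi ∧ Θ ≤ (f i + 3) + (x i + 3) then (f i + 3).choose δ else 0) ≤
      ∑ i ∈ s, (if lo + δ ≤ f i + 3 ∧ f i + 3 ≤ hi + δ then (f i + 3).choose δ else 0) :=
    PLDClosure.shift11 s (fun i => x i + 2) (fun i => f i + 2) h22 lo hi δ Θ hΘ hlo
  -- the seven layers, for `m` and for `m₀`
  have hLm : ∀ n : ℕ, 5 ≤ n → ∀ i ∈ s, ∑ j ∈ range (n + 1), Nat.choose n j *
        (if lo ≤ x i + min j 3 ∧ x i + min j 3 ≤ hi ∧ Θ ≤ (f i + min (n - j) 3) + (x i + min j 3) then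
          (f i + min (n - j) 3).choose δ else 0) =
      (if lo ≤ x i ∧ x i ≤ hi ∧ Θ ≤ (f i + 3) + x i then (f i + 3).choose δ else 0) +
        n * (if lo ≤ x i + 1 ∧ x i + 1 ≤ hi ∧ Θ ≤ (f i + 3) + (x i + 1) then (f i + 3).choose δ else 0) +
        n.choose 2 * (if lo ≤ x i + 2 ∧ x i + 2 ≤ hi ∧ Θ ≤ (f i + 3) + (x i + 2) then (f i + 3).choose δ else 0) +
        (∑ i ∈ Ico 3 (n - 2), n.choose i) *
          (if lo ≤ x i + 3 ∧ x i + 3 ≤ hi ∧ Θ ≤ (f i + 3) + (x i + 3) then (f i + 3).choose δ else 0) +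
        n.choose 2 * (if lo ≤ x i + 3 ∧ x i + 3 ≤ hi ∧ Θ ≤ (f i + 2) + (x i + 3) then (f i + 2).choose δ else 0) +
        n * (if lo ≤ x i + 3 ∧ x i + 3 ≤ hi ∧ Θ ≤ (f i + 1) + (x i + 3) then (f i + 1).choose δ else 0) +
        (if lo ≤ x i + 3 ∧ x i + 3 ≤ hi ∧ Θ ≤ f i + (x i + 3) then (f i).choose δ else 0) :=
    fun n hn i _ => PLDPlaneLift.sum_choose_min_three n hn
      (fun a b => if lo ≤ x i + a ∧ x i + a ≤ hi ∧ Θ ≤ (f i + b) + (x i + a) then (f i + b).choose δ else 0)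
  have hRm : ∀ n : ℕ, 5 ≤ n → ∀ i ∈ s, ∑ j ∈ range (n + 1), Nat.choose n j *
        (if lo + δ ≤ f i + min (n - j) 3 ∧ f i + min (n - j) 3 ≤ hi + δ then (f i + min (n - j) 3).choose δ else 0) =
      (if lo + δ ≤ f i + 3 ∧ f i + 3 ≤ hi + δ then (f i + 3).choose δ else 0) +
        n * (if lo + δ ≤ f i + 3 ∧ f i + 3 ≤ hi + δ then (f i + 3).choose δ else 0) +
        n.choose 2 * (if lo + δ ≤ f i + 3 ∧ f i + 3 ≤ hi + δ then (f i + 3).choose δ else 0) +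
        (∑ i ∈ Ico 3 (n - 2), n.choose i) * (if lo + δ ≤ f i + 3 ∧ f i + 3 ≤ hi + δ then (f i + 3).choose δ else 0) +
        n.choose 2 * (if lo + δ ≤ f i + 2 ∧ f i + 2 ≤ hi + δ then (f i + 2).choose δ else 0) +
        n * (if lo + δ ≤ f i + 1 ∧ f i + 1 ≤ hi + δ then (f i + 1).choose δ else 0) +
        (if lo + δ ≤ f i ∧ f i ≤ hi + δ then (f i).choose δ else 0) :=
    fun n hn i _ => PLDPlaneLift.sum_choose_min_three n hn
      (fun _ b => if lo + δ ≤ f i + b ∧ f i + b ≤ hi + δ then (f i + b).choose δ else 0)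
  rw [sum_congr rfl (hLm m (by omega)), sum_congr rfl (hRm m (by omega))]
  rw [sum_congr rfl (hLm m₀ (by omega)), sum_congr rfl (hRm m₀ (by omega))] at h₀
  simp only [sum_add_distrib, ← mul_sum] at h₀ hq ⊢
  rw [sum_add_distrib, sum_add_distrib] at hT
  -- the coefficients
  obtain ⟨k, hk⟩ := Nat.exists_eq_add_of_le hm
  obtain ⟨k', hk'⟩ := Nat.exists_eq_add_of_le (PLDPlaneLift.sum_choose_mid3_mono m₀ m hm)
  have hC := PLDPlaneLift.two_mul_choose_two_sub m₀ m hm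
  rw [show m - m₀ = k by omega] at hC
  obtain ⟨u, hu⟩ : ∃ u, k * (m + m₀ - 1) = k * (12 + u) := by
    rcases Nat.eq_zero_or_pos k with hk0 | hkpos
    · exact ⟨0, by rw [hk0]; simp⟩
    · exact ⟨m + m₀ - 13, by rw [show m + m₀ - 1 = 12 + (m + m₀ - 13) by omega]⟩
  rw [hu] at hC
  rw [hk']
  rw [hk] at hC ⊢
  exact lift_alg_b6 _ _ _ _ _ _ _ _ _ _ _ _ _ _ _ _ _ _ _ _ _ hC h₀ hq hT hS


end PLDPlaneLiftB6

end PercRepro
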